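import Summits.HodgeConjecture.HodgeConjecture.Theorems.Ring2WeilCoverageNormTableB
import HarnessLib

/-!
# Weil-type family coverage — FRAME-FREE placement of the quaternionic `G`-Pryms (ring2-b04, gen 46)

research route conditional on HC_CM; not a corollary; Q11.4-sentence-2 already refuted in dim ≥ 3.

Ring 2, WEIL-TYPE FAMILY-COVERAGE CENSUS (`HOME/WEIL-FAMILY-COVERAGE.md` `## b04`, block b04.10 «GROUP-PRYM PLACEMENT
round 4: the frame-free placement theorem», owner ring2-b04).  Setting of b04.8/b04.9: a `Dic_n`-cover `C̃ → X`, the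
quaternion piece `V ⊂ H¹(C̃, ℚ)` on which `ℚ[Dic_n]` acts through the definite quaternion algebra
`D_n = (ℚ(ζ_{2n})/F, conj, -1)`, `F = ℚ(ζ_{2n})⁺`, `e = [F : ℚ]`, `V ≅ D_n^k`, `E` = the cup form.  The seat-derived
FRAME-FREE PLACEMENT THEOREM of b04.10 (A) (S-pencil in the census file; inputs: the Scharlau transfer of a rank-`2k`
hermitian form over `F·K / K` has discriminant `N_{F/ℚ}(det) · d_F^{2k}`, and the corestriction identity
`(-d, N_{F/ℚ} t)_p = ∏_{v ∣ p} (-d, t)_v` for Hilbert symbols) says: for EVERY imaginary quadratic `K = ℚ(√-d) ⊂ D_n`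
the Weil structure `(P, K, Θ|_P)` is balanced of signature `(ek, ek)` and its discriminant class is

  `a(P, K) ≡ C(P, Θ) · N_{F/ℚ}(ν_K)^k (mod Nm(Kˣ))`,  `C(P, Θ) := N_{F/ℚ}(Nrd c^t) ∈ ℚ_{>0}`,

where `c ∈ M_k(D_n)` is the matrix of `E` on a `D_n`-basis of `V` (`E(v_i, d v_j) = Tr_{F/ℚ} trd(c_{ij} d)`),
INDEPENDENT OF `K`, and `N_{F/ℚ}(ν_K)` (`D_n = (-d, -ν_K)_F`) is a norm from `K` up to the finite set
`R(D_n) = {p : ∏_{v∣p} ε_v(D_n) = -1}` and the sign `(-1)^e` — both trivial for `n = p ≡ 1 (mod 4)`.  The census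
computes `C` EXACTLY per datum (`census-g46/cinv.py`, engine byte copies; no `K`-frame, no lattice, no search).

This file carries the ARITHMETIC SHELLS of that theorem and the census sentences it decides:

* §0 the bookkeeping shell `mem_iff_of_eq_mul_norm_mul_sq` (`a = C · ν · s²` with `ν` a norm ⟹ `[a] = [C]`) and
  its class form for even `n`;
* §1 norm facts at the new fields (one line each over `Ring2WeilCoverageNormCriteria`): `SqrtNeg43.not_mem_5/7`,
  `SqrtNeg67.not_mem_5/7/11`, `SqrtNeg163.not_mem_5/7/11`, `SqrtNeg13.not_mem_5`, `SqrtNeg23.not_mem_5`,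
  `SqrtNeg2.mem_17`;
* §2 the HONEST RATIONAL FRAME on the `Dic₁₃` CM twelvefold `P₁₃ ⊂ J(y² = x(x²⁶ - 1))` for the 13-INERT field
  `ℚ(√-2)` (no integral frame exists in `ℤ[Dic₁₃]`, b04.9 P.S. 2 (η)): `x = g·y/13`, `g` the quadratic Gauss sum in
  `a²`, `y² = -26`; exact determinant `q = 4352/169 = 17·(16/13)²` ⟹ SPLIT (`twelvefold_sqrtNeg2_dic13_mk_ratFrame_eq_split`)
  — correcting the PREDICTION «`W12.2.13`» of b04.9 (C6) (the conditional K2 sentences of `…DicyclicPlacementB` stay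
  correct: their hypothesis, a norm-index integral frame, is never met);
* §3 frame-free census sentences with the literal invariants `C`: `P₁₃` (`C = 13⁻¹⁰`) is SPLIT for EVERY `K`
  (`twelvefold_dic13_mk_C_eq_split`, all `d` at once); the `Dic₅` eightfold family `(0; 4,4,10,5)` (`C = 6⁴/5³ ≡ 5`,
  `k = 2`) is NON-split on `W8.d.5` for `d ∈ {7, 13, 23, 43, 67, 163}`; and the new cell keys of the `Dic₇`, `Dic₉`,
  `Dic₁₁` CM points at `ℚ(√-43)`, `ℚ(√-67)`, `ℚ(√-163)` (`W6.d.7`, `W6.d.3`, `W10.d.11`).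

No `def`, no named fact, no `sorry`; nothing here is a statement about Hodge classes; `HC_CM` is used nowhere.

References: [cite: vanGeemen1994HodgeAV, 5.4 and (5.4.1)]; [cite: Serre1973, Ch. III §1]; [cite: Scharlau1985, Ch. 2 §5 (transfer)].
-/

noncomputable section

set_option linter.dupNamespace false

open Literature.AlgebraicGeometry.Motives
open Literature.AlgebraicGeometry.VanGeemen1994
open Summit.HodgeConjecture.HodgeConjecture.Ring2.Hypotheses

namespace Summit.HodgeConjecture.HodgeConjecture.Ring2.WeilCoverage

/-! ### §0 The bookkeeping shell of the frame-free placement theorem -/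

/-- **Shell of the frame-free law**: if the discriminant `a` of `(P, K, Θ)` factors as `a = C · ν · s²` with `ν` a norm
from `K = ℚ(√-d)` (the `N_{F/ℚ}(ν_K)^k`-factor of b04.10 (A) when `k` is even or `R(D) = ∅`, `e` even), then the class
of `a` is the class of the `K`-INDEPENDENT invariant `C = N_{F/ℚ}(Nrd c^t)`.
research route conditional on HC_CM; not a corollary; Q11.4-sentence-2 already refuted in dim ≥ 3. [cite: vanGeemen1994HodgeAV, (5.4.1)] -/
theorem mem_iff_of_eq_mul_norm_mul_sq {d : ℕ} {a C ν s : ℚ} (ha : a ≠ 0) (hC : C ≠ 0) (hν : ν ≠ 0) (hs : s ≠ 0)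
    (h : a = C * ν * s ^ 2) (hνN : Units.mk0 ν hν ∈ normUnitsSubgroup ℚ (weilField d)) :
    Units.mk0 a ha ∈ normUnitsSubgroup ℚ (weilField d) ↔ Units.mk0 C hC ∈ normUnitsSubgroup ℚ (weilField d) := by
  have e : Units.mk0 a ha = Units.mk0 C hC * (Units.mk0 ν hν * Units.mk0 (s ^ 2) (pow_ne_zero 2 hs)) :=
    Units.ext (by simp only [Units.val_mul, Units.val_mk0]; rw [h]; ring)
  rw [e]
  exact Subgroup.mul_mem_cancel_right _ (Subgroup.mul_mem _ hνN (sq_mem_normUnitsSubgroup hs))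

/-- Class form, `n` even (`g = 2n`; `δ = det H = a`): under `a = C · ν · s²` with `ν ∈ Nm(K_dˣ)` the component of
`(P, K, Θ)` is the split one iff `C ∈ Nm(K_dˣ)` — one rational number decides every field `K` at once.
research route conditional on HC_CM; not a corollary; Q11.4-sentence-2 already refuted in dim ≥ 3. [cite: vanGeemen1994HodgeAV, (5.4.1)] -/
theorem mk_eq_split_iff_of_eq_mul_norm_mul_sq {d n : ℕ} (hn : Even n) {a C ν s : ℚ} (ha : a ≠ 0) (hC : C ≠ 0)
    (hν : ν ≠ 0) (hs : s ≠ 0) (h : a = C * ν * s ^ 2) (hνN : Units.mk0 ν hν ∈ normUnitsSubgroup ℚ (weilField d)) :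
    (QuotientGroup.mk (Units.mk0 a ha) : weilNormResidueGroup d) = splitDiscriminantClass n d ↔
      Units.mk0 C hC ∈ normUnitsSubgroup ℚ (weilField d) := by
  rw [mk_eq_splitDiscriminantClass_iff_of_even hn, mem_iff_of_eq_mul_norm_mul_sq ha hC hν hs h hνN]

/-! ### §1 Norm facts at the new fields -/

namespace SqrtNeg2

/-- `17 ∈ Nm(ℚ(√-2)ˣ)`: `17 = 3² + 2·2²`. research route conditional on HC_CM; not a corollary; Q11.4-sentence-2 already refuted in dim ≥ 3. [cite: vanGeemen1994HodgeAV, (5.4.1)] -/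
theorem mem_17 : Units.mk0 (17 : ℚ) (by norm_num) ∈ normUnitsSubgroup ℚ (weilField 2) :=
  mem_normUnitsSubgroup_of_sq_add_mul_sq _ 3 2 (by norm_num)

end SqrtNeg2

namespace SqrtNeg13

/-- `5 ∉ Nm(ℚ(√-13)ˣ)`: descent at the inert prime `5` (`-13 ≡ 2` is a non-square mod `5`, `5 ∥ 5`).
research route conditional on HC_CM; not a corollary; Q11.4-sentence-2 already refuted in dim ≥ 3. [cite: Serre1973, Ch. III §1] -/
theorem not_mem_5 : Units.mk0 (5 : ℚ) (by norm_num) ∉ normUnitsSubgroup ℚ (weilField 13) := by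
  simpa using natCast_not_mem_normUnitsSubgroup_of_inert (d := 13) (a := 5) (p := 5)
    (by norm_num) (by decide) (by norm_num) (by norm_num) (by norm_num)

end SqrtNeg13

namespace SqrtNeg23

/-- `5 ∉ Nm(ℚ(√-23)ˣ)`: descent at the inert prime `5` (`-23 ≡ 2` is a non-square mod `5`).
research route conditional on HC_CM; not a corollary; Q11.4-sentence-2 already refuted in dim ≥ 3. [cite: Serre1973, Ch. III §1] -/
theorem not_mem_5 : Units.mk0 (5 : ℚ) (by norm_num) ∉ normUnitsSubgroup ℚ (weilField 23) := by
  simpa using natCast_not_mem_normUnitsSubgroup_of_inert (d := 23) (a := 5) (p := 5)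
    (by norm_num) (by decide) (by norm_num) (by norm_num) (by norm_num)

end SqrtNeg23

namespace SqrtNeg43

/-- `5 ∉ Nm(ℚ(√-43)ˣ)`: descent at the inert prime `5` (`-43 ≡ 2` is a non-square mod `5`).
research route conditional on HC_CM; not a corollary; Q11.4-sentence-2 already refuted in dim ≥ 3. [cite: Serre1973, Ch. III §1] -/
theorem not_mem_5 : Units.mk0 (5 : ℚ) (by norm_num) ∉ normUnitsSubgroup ℚ (weilField 43) := by
  simpa using natCast_not_mem_normUnitsSubgroup_of_inert (d := 43) (a := 5) (p := 5)
    (by norm_num) (by decide) (by norm_num) (by norm_num) (by norm_num)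

/-- `7 ∉ Nm(ℚ(√-43)ˣ)`: descent at the inert prime `7` (`-43 ≡ 6` is a non-square mod `7`).
research route conditional on HC_CM; not a corollary; Q11.4-sentence-2 already refuted in dim ≥ 3. [cite: Serre1973, Ch. III §1] -/
theorem not_mem_7 : Units.mk0 (7 : ℚ) (by norm_num) ∉ normUnitsSubgroup ℚ (weilField 43) := by
  simpa using natCast_not_mem_normUnitsSubgroup_of_inert (d := 43) (a := 7) (p := 7)
    (by norm_num) (by decide) (by norm_num) (by norm_num) (by norm_num)

end SqrtNeg43

namespace SqrtNeg67

/-- `5 ∉ Nm(ℚ(√-67)ˣ)`: descent at the inert prime `5` (`-67 ≡ 3` is a non-square mod `5`).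
research route conditional on HC_CM; not a corollary; Q11.4-sentence-2 already refuted in dim ≥ 3. [cite: Serre1973, Ch. III §1] -/
theorem not_mem_5 : Units.mk0 (5 : ℚ) (by norm_num) ∉ normUnitsSubgroup ℚ (weilField 67) := by
  simpa using natCast_not_mem_normUnitsSubgroup_of_inert (d := 67) (a := 5) (p := 5)
    (by norm_num) (by decide) (by norm_num) (by norm_num) (by norm_num)

/-- `7 ∉ Nm(ℚ(√-67)ˣ)`: descent at the inert prime `7` (`-67 ≡ 3` is a non-square mod `7`).
research route conditional on HC_CM; not a corollary; Q11.4-sentence-2 already refuted in dim ≥ 3. [cite: Serre1973, Ch. III §1] -/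
theorem not_mem_7 : Units.mk0 (7 : ℚ) (by norm_num) ∉ normUnitsSubgroup ℚ (weilField 67) := by
  simpa using natCast_not_mem_normUnitsSubgroup_of_inert (d := 67) (a := 7) (p := 7)
    (by norm_num) (by decide) (by norm_num) (by norm_num) (by norm_num)

/-- `11 ∉ Nm(ℚ(√-67)ˣ)`: descent at the inert prime `11` (`-67 ≡ 10` is a non-square mod `11`).
research route conditional on HC_CM; not a corollary; Q11.4-sentence-2 already refuted in dim ≥ 3. [cite: Serre1973, Ch. III §1] -/
theorem not_mem_11 : Units.mk0 (11 : ℚ) (by norm_num) ∉ normUnitsSubgroup ℚ (weilField 67) := by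
  simpa using natCast_not_mem_normUnitsSubgroup_of_inert (d := 67) (a := 11) (p := 11)
    (by norm_num) (by decide) (by norm_num) (by norm_num) (by norm_num)

end SqrtNeg67

namespace SqrtNeg163

/-- `5 ∉ Nm(ℚ(√-163)ˣ)`: descent at the inert prime `5` (`-163 ≡ 2` is a non-square mod `5`).
research route conditional on HC_CM; not a corollary; Q11.4-sentence-2 already refuted in dim ≥ 3. [cite: Serre1973, Ch. III §1] -/
theorem not_mem_5 : Units.mk0 (5 : ℚ) (by norm_num) ∉ normUnitsSubgroup ℚ (weilField 163) := by
  simpa using natCast_not_mem_normUnitsSubgroup_of_inert (d := 163) (a := 5) (p := 5)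
    (by norm_num) (by decide) (by norm_num) (by norm_num) (by norm_num)

/-- `7 ∉ Nm(ℚ(√-163)ˣ)`: descent at the inert prime `7` (`-163 ≡ 5` is a non-square mod `7`).
research route conditional on HC_CM; not a corollary; Q11.4-sentence-2 already refuted in dim ≥ 3. [cite: Serre1973, Ch. III §1] -/
theorem not_mem_7 : Units.mk0 (7 : ℚ) (by norm_num) ∉ normUnitsSubgroup ℚ (weilField 163) := by
  simpa using natCast_not_mem_normUnitsSubgroup_of_inert (d := 163) (a := 7) (p := 7)
    (by norm_num) (by decide) (by norm_num) (by norm_num) (by norm_num)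

/-- `11 ∉ Nm(ℚ(√-163)ˣ)`: descent at the inert prime `11` (`-163 ≡ 2` is a non-square mod `11`).
research route conditional on HC_CM; not a corollary; Q11.4-sentence-2 already refuted in dim ≥ 3. [cite: Serre1973, Ch. III §1] -/
theorem not_mem_11 : Units.mk0 (11 : ℚ) (by norm_num) ∉ normUnitsSubgroup ℚ (weilField 163) := by
  simpa using natCast_not_mem_normUnitsSubgroup_of_inert (d := 163) (a := 11) (p := 11)
    (by norm_num) (by decide) (by norm_num) (by norm_num) (by norm_num)

end SqrtNeg163

/-! ### §2 The honest rational frame on the `Dic₁₃` CM twelvefold for the 13-inert field `ℚ(√-2)` -/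

/-- **`P₁₃` is SPLIT for `ℚ(√-2)` (row `W12.2.1`), by an explicit RATIONAL `K`-frame.**  On the `Dic₁₃` quaternion
piece `V` (`dim 24`) of `y² = x(x²⁶ - 1)` the element `x := g · y / 13 ∈ ℚ[Dic₁₃]` — `g = Σ_{k=1}^{12} (k/13) a^{2k}`
the quadratic Gauss sum (`g² = 13` on `V`, central in `D₁₃`), `y ∈ ℤ[Dic₁₃]` the integral frame with `y² = -26` of
b04.9 (β) — satisfies `x² = -2`, `x* = -x`, `K`-signature `(6,6)`; the exact determinant of the hermitian form on the
`K`-frame `{v_i, x v_i}` (engine convention) is `q = det H = 4352/169 = 17 · (16/13)²`, and `17 = 3² + 2·2²` is a norm: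
the class `[q]` (`n = 6` even) is the split class.  This decides the cell left «uncertified» in b04.9 P.S. 2 (η) and
CORRECTS the prediction «`W12.2.13`» of b04.9 (C6).
research route conditional on HC_CM; not a corollary; Q11.4-sentence-2 already refuted in dim ≥ 3. [cite: vanGeemen1994HodgeAV, (5.4.1)] -/
theorem twelvefold_sqrtNeg2_dic13_mk_ratFrame_eq_split :
    (QuotientGroup.mk (Units.mk0 ((4352 : ℚ) / 169) (by norm_num)) : weilNormResidueGroup 2) =
      splitDiscriminantClass 6 2 :=
  (mk_eq_split_iff_of_eq_mul_norm_mul_sq (n := 6) (by decide) (a := (4352 : ℚ) / 169) (C := 17) (ν := 1) (s := 16 / 13)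
    (by norm_num) (by norm_num) one_ne_zero (by norm_num) (by norm_num) SqrtNeg2.mem_1).2 SqrtNeg2.mem_17

/-- Control on the same point, `K = ℚ(i)` through the rational frame `x = g · y₁₃ / 13` (`y₁₃² = -13`): exact
`q = 3125/28561 = 5 · (25/169)²`, `5 = 2² + 1²` ⟹ split (`W12.1.1`), in agreement with the integral frame `x = b`
(`q = 13 = 3² + 2²`) and with b04.9 (C6).
research route conditional on HC_CM; not a corollary; Q11.4-sentence-2 already refuted in dim ≥ 3. [cite: vanGeemen1994HodgeAV, (5.4.1)] -/
theorem twelvefold_sqrtNeg1_dic13_mk_ratFrame_eq_split :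
    (QuotientGroup.mk (Units.mk0 ((3125 : ℚ) / 28561) (by norm_num)) : weilNormResidueGroup 1) =
      splitDiscriminantClass 6 1 :=
  (mk_eq_split_iff_of_eq_mul_norm_mul_sq (n := 6) (by decide) (a := (3125 : ℚ) / 28561) (C := 5) (ν := 1) (s := 25 / 169)
    (by norm_num) (by norm_num) one_ne_zero (by norm_num) (by norm_num) SqrtNeg1.mem_1).2 SqrtNeg1.mem_5

/-! ### §3 Frame-free census sentences (literal invariants `C = N_{F/ℚ}(Nrd c^t)` of the census engine) -/

/-- **The `Dic₁₃` CM twelvefold `P₁₃` is SPLIT for EVERY imaginary quadratic field** (`W12.d.1` for all `d`): its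
frame-free invariant is `C(P₁₃, Θ|) = N_{F/ℚ}(Nrd c) = 13⁻¹⁰`, a rational SQUARE, and for `D₁₃` (`13 ≡ 1 (mod 4)`:
`e = 6` even, `R(D₁₃) = ∅`) the correction factor `N_{F/ℚ}(ν_K)` is a norm from every `K` — so `a(P₁₃, K) ≡ C ≡ 1`.
In particular the nine 13-inert census fields `ℚ(√-2), ℚ(√-7), ℚ(√-11), ℚ(√-19), ℚ(√-67), ℚ(√-163), ℚ(√-5), ℚ(√-6),
ℚ(√-15)` — for which NO integral frame exists in `ℤ[Dic₁₃]` — see `P₁₃` on their SPLIT twelvefold component.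
research route conditional on HC_CM; not a corollary; Q11.4-sentence-2 already refuted in dim ≥ 3. [cite: vanGeemen1994HodgeAV, (5.4.1)] -/
theorem twelvefold_dic13_mk_C_eq_split (d : ℕ) :
    (QuotientGroup.mk (Units.mk0 ((1 : ℚ) / 13 ^ 10) (by norm_num)) : weilNormResidueGroup d) =
      splitDiscriminantClass 6 d := by
  rw [mk_eq_splitDiscriminantClass_iff_of_even (by decide)]
  have e : Units.mk0 ((1 : ℚ) / 13 ^ 10) (by norm_num) =
      Units.mk0 (((1 : ℚ) / 13 ^ 5) ^ 2) (pow_ne_zero 2 (by norm_num)) := Units.ext (by norm_num)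
  rw [e]
  exact sq_mem_normUnitsSubgroup (by norm_num)

/-- **The `Dic₁₁` CM tenfold `P₁₁ ⊂ J(y² = x(x²² - 1))` at `ℚ(√-67)`: NON-split, row `W10.67.11`** (`T = {11, 67}`).
Frame-free: `C(P₁₁) = 11⁻⁸` is a square, `e = 5` odd, `R(D₁₁) = {11}`, so `T_K(a) = T_K(-1) Δ {11} = {67} Δ {11}`;
the class is that of `11`, and `11` is inert in `ℚ(√-67)`.  Cell key (`n = 5` odd, `δ = -a`): `[-11] ≠ split`.
(b04.9 (C6) predicted «`[11]·index`»; no integral frame in the search box — decided here without a frame.)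
research route conditional on HC_CM; not a corollary; Q11.4-sentence-2 already refuted in dim ≥ 3. [cite: vanGeemen1994HodgeAV, (5.4.1)] -/
theorem tenfold_sqrtNeg67_neg11_ne_split :
    (QuotientGroup.mk (Units.mk0 (-(11 : ℚ)) (by norm_num)) : weilNormResidueGroup 67) ≠
      splitDiscriminantClass 5 67 :=
  mk_neg_ne_split_of_odd (by decide) (by norm_num) SqrtNeg67.not_mem_11

/-- **`P₁₁` at `ℚ(√-163)`: NON-split, row `W10.163.11`** (`T = {11, 163}`; `11` inert in `ℚ(√-163)`).
research route conditional on HC_CM; not a corollary; Q11.4-sentence-2 already refuted in dim ≥ 3. [cite: vanGeemen1994HodgeAV, (5.4.1)] -/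
theorem tenfold_sqrtNeg163_neg11_ne_split :
    (QuotientGroup.mk (Units.mk0 (-(11 : ℚ)) (by norm_num)) : weilNormResidueGroup 163) ≠
      splitDiscriminantClass 5 163 :=
  mk_neg_ne_split_of_odd (by decide) (by norm_num) SqrtNeg163.not_mem_11

/-- **The `Dic₇` CM sixfold `P₇ = A_(28; 1,14,13) ~ B₇² ⊂ J(y² = x(x¹⁴ - 1))` at `ℚ(√-43)`, `ℚ(√-67)`, `ℚ(√-163)`:
NON-split, rows `W6.43.7`, `W6.67.7`, `W6.163.7`** (frame-free: `C(P₇) = 7⁻⁴` square, `e = 3` odd, `R(D₇) = {7}`,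
`T_K(a) = T_K(-1) Δ {7} = {d} Δ {7}`, the class of `7`; `7` inert in each field — which is also the embeddability
condition `ℚ(√-d) ⊂ D₇`).  HC for `P₇` and its powers is in print [Aoki02 1.2] (b04.9 (C5)); the rows are placements only.
Cell key at `d = 43` (`n = 3` odd): `[-7] ≠ split`.
research route conditional on HC_CM; not a corollary; Q11.4-sentence-2 already refuted in dim ≥ 3. [cite: vanGeemen1994HodgeAV, (5.4.1)] -/
theorem sixfold_sqrtNeg43_neg7_ne_split :
    (QuotientGroup.mk (Units.mk0 (-(7 : ℚ)) (by norm_num)) : weilNormResidueGroup 43) ≠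
      splitDiscriminantClass 3 43 :=
  mk_neg_ne_split_of_odd (by decide) (by norm_num) SqrtNeg43.not_mem_7

/-- `P₇` at `ℚ(√-67)`: row `W6.67.7`, cell key `[-7] ≠ split 3 67`. research route conditional on HC_CM; not a corollary; Q11.4-sentence-2 already refuted in dim ≥ 3. [cite: vanGeemen1994HodgeAV, (5.4.1)] -/
theorem sixfold_sqrtNeg67_neg7_ne_split :
    (QuotientGroup.mk (Units.mk0 (-(7 : ℚ)) (by norm_num)) : weilNormResidueGroup 67) ≠
      splitDiscriminantClass 3 67 :=
  mk_neg_ne_split_of_odd (by decide) (by norm_num) SqrtNeg67.not_mem_7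

/-- `P₇` at `ℚ(√-163)`: row `W6.163.7`, cell key `[-7] ≠ split 3 163`. research route conditional on HC_CM; not a corollary; Q11.4-sentence-2 already refuted in dim ≥ 3. [cite: vanGeemen1994HodgeAV, (5.4.1)] -/
theorem sixfold_sqrtNeg163_neg7_ne_split :
    (QuotientGroup.mk (Units.mk0 (-(7 : ℚ)) (by norm_num)) : weilNormResidueGroup 163) ≠
      splitDiscriminantClass 3 163 :=
  mk_neg_ne_split_of_odd (by decide) (by norm_num) SqrtNeg163.not_mem_7

/-- **The `Dic₉` CM sixfold `P₉ = A_(36; 1,18,17) ~ B₉² ⊂ J(y² = x(x¹⁸ - 1))` at `ℚ(√-43)`, `ℚ(√-67)`, `ℚ(√-163)`: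
NON-split, rows `W6.43.3`, `W6.67.3`, `W6.163.3`** (frame-free: `C(P₉) = 3⁻⁶` square, `F = ℚ(ζ₁₈)⁺` cubic,
`R(D₉) = {3}`, `T_K(a) = {d} Δ {3}`, the class of `3`; `3` inert in each field; HC for `P₉` and powers in print
[Aoki02 1.2], `M = 36`).  Cell key at `d = 43`: `[-3] ≠ split 3 43`.
research route conditional on HC_CM; not a corollary; Q11.4-sentence-2 already refuted in dim ≥ 3. [cite: vanGeemen1994HodgeAV, (5.4.1)] -/
theorem sixfold_sqrtNeg43_neg3_ne_split :
    (QuotientGroup.mk (Units.mk0 (-(3 : ℚ)) (by norm_num)) : weilNormResidueGroup 43) ≠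
      splitDiscriminantClass 3 43 :=
  mk_neg_ne_split_of_odd (by decide) (by norm_num) SqrtNeg43.not_mem_3

/-- `P₉` at `ℚ(√-67)`: row `W6.67.3`, cell key `[-3] ≠ split 3 67`. research route conditional on HC_CM; not a corollary; Q11.4-sentence-2 already refuted in dim ≥ 3. [cite: vanGeemen1994HodgeAV, (5.4.1)] -/
theorem sixfold_sqrtNeg67_neg3_ne_split :
    (QuotientGroup.mk (Units.mk0 (-(3 : ℚ)) (by norm_num)) : weilNormResidueGroup 67) ≠
      splitDiscriminantClass 3 67 :=
  mk_neg_ne_split_of_odd (by decide) (by norm_num) SqrtNeg67.not_mem_3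

/-- `P₉` at `ℚ(√-163)`: row `W6.163.3`, cell key `[-3] ≠ split 3 163`. research route conditional on HC_CM; not a corollary; Q11.4-sentence-2 already refuted in dim ≥ 3. [cite: vanGeemen1994HodgeAV, (5.4.1)] -/
theorem sixfold_sqrtNeg163_neg3_ne_split :
    (QuotientGroup.mk (Units.mk0 (-(3 : ℚ)) (by norm_num)) : weilNormResidueGroup 163) ≠
      splitDiscriminantClass 3 163 :=
  mk_neg_ne_split_of_odd (by decide) (by norm_num) SqrtNeg163.not_mem_3

/-- **The `Dic₅` eightfold FAMILY `(0; 4,4,10,5)` (Hurwitz dimension 1, `k = 2`, type `(1⁴,2³,10)`) has the frame-free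
invariant `C = N_{ℚ(√5)/ℚ}(Nrd c^t) = 1296/125 = 5 · (36/25)²`; `k` even ⟹ NO correction term: `a(P_t, K) ≡ 5` for EVERY
`K`** (the b04.8 engine rows `W8.3.5`, `W8.2.5`, `W8.6.2`, `W8.10.2`, `W8.15.2`, `W8.1.1`, … are this one rational number
read in the fifteen norm groups).  At `ℚ(√-7)` (`5` inert): NON-split, row `W8.7.5` — literally `[1296/125] ≠ split 4 7`.
research route conditional on HC_CM; not a corollary; Q11.4-sentence-2 already refuted in dim ≥ 3. [cite: vanGeemen1994HodgeAV, (5.4.1)] -/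
theorem eightfold_sqrtNeg7_dic5Family_mk_C_ne_split :
    (QuotientGroup.mk (Units.mk0 ((1296 : ℚ) / 125) (by norm_num)) : weilNormResidueGroup 7) ≠
      splitDiscriminantClass 4 7 := by
  rw [Ne, mk_eq_split_iff_of_eq_mul_norm_mul_sq (n := 4) (by decide) (a := (1296 : ℚ) / 125) (C := 5) (ν := 1) (s := 36 / 25)
    (by norm_num) (by norm_num) one_ne_zero (by norm_num) (by norm_num) SqrtNeg7.mem_1]
  exact Summit.HodgeConjecture.Ring2WeilNormDescent.five_not_mem_norm_seven

/-- The same family at `ℚ(√-13)`: row `W8.13.5` (`[1296/125] = [5] ≠ split 4 13`). research route conditional on HC_CM; not a corollary; Q11.4-sentence-2 already refuted in dim ≥ 3. [cite: vanGeemen1994HodgeAV, (5.4.1)] -/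
theorem eightfold_sqrtNeg13_dic5Family_mk_C_ne_split :
    (QuotientGroup.mk (Units.mk0 ((1296 : ℚ) / 125) (by norm_num)) : weilNormResidueGroup 13) ≠
      splitDiscriminantClass 4 13 := by
  rw [Ne, mk_eq_split_iff_of_eq_mul_norm_mul_sq (n := 4) (by decide) (a := (1296 : ℚ) / 125) (C := 5) (ν := 1) (s := 36 / 25)
    (by norm_num) (by norm_num) one_ne_zero (by norm_num) (by norm_num)
    (mem_normUnitsSubgroup_of_sq_add_mul_sq _ 1 0 (by norm_num))]
  exact SqrtNeg13.not_mem_5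

/-- The same family at `ℚ(√-23)`: row `W8.23.5`. research route conditional on HC_CM; not a corollary; Q11.4-sentence-2 already refuted in dim ≥ 3. [cite: vanGeemen1994HodgeAV, (5.4.1)] -/
theorem eightfold_sqrtNeg23_dic5Family_mk_C_ne_split :
    (QuotientGroup.mk (Units.mk0 ((1296 : ℚ) / 125) (by norm_num)) : weilNormResidueGroup 23) ≠
      splitDiscriminantClass 4 23 := by
  rw [Ne, mk_eq_split_iff_of_eq_mul_norm_mul_sq (n := 4) (by decide) (a := (1296 : ℚ) / 125) (C := 5) (ν := 1) (s := 36 / 25)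
    (by norm_num) (by norm_num) one_ne_zero (by norm_num) (by norm_num)
    (mem_normUnitsSubgroup_of_sq_add_mul_sq _ 1 0 (by norm_num))]
  exact SqrtNeg23.not_mem_5

/-- The same family at `ℚ(√-43)`: row `W8.43.5`. research route conditional on HC_CM; not a corollary; Q11.4-sentence-2 already refuted in dim ≥ 3. [cite: vanGeemen1994HodgeAV, (5.4.1)] -/
theorem eightfold_sqrtNeg43_dic5Family_mk_C_ne_split :
    (QuotientGroup.mk (Units.mk0 ((1296 : ℚ) / 125) (by norm_num)) : weilNormResidueGroup 43) ≠
      splitDiscriminantClass 4 43 := by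
  rw [Ne, mk_eq_split_iff_of_eq_mul_norm_mul_sq (n := 4) (by decide) (a := (1296 : ℚ) / 125) (C := 5) (ν := 1) (s := 36 / 25)
    (by norm_num) (by norm_num) one_ne_zero (by norm_num) (by norm_num)
    (mem_normUnitsSubgroup_of_sq_add_mul_sq _ 1 0 (by norm_num))]
  exact SqrtNeg43.not_mem_5

/-- The same family at `ℚ(√-67)`: row `W8.67.5`. research route conditional on HC_CM; not a corollary; Q11.4-sentence-2 already refuted in dim ≥ 3. [cite: vanGeemen1994HodgeAV, (5.4.1)] -/
theorem eightfold_sqrtNeg67_dic5Family_mk_C_ne_split :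
    (QuotientGroup.mk (Units.mk0 ((1296 : ℚ) / 125) (by norm_num)) : weilNormResidueGroup 67) ≠
      splitDiscriminantClass 4 67 := by
  rw [Ne, mk_eq_split_iff_of_eq_mul_norm_mul_sq (n := 4) (by decide) (a := (1296 : ℚ) / 125) (C := 5) (ν := 1) (s := 36 / 25)
    (by norm_num) (by norm_num) one_ne_zero (by norm_num) (by norm_num)
    (mem_normUnitsSubgroup_of_sq_add_mul_sq _ 1 0 (by norm_num))]
  exact SqrtNeg67.not_mem_5

/-- The same family at `ℚ(√-163)`: row `W8.163.5`. research route conditional on HC_CM; not a corollary; Q11.4-sentence-2 already refuted in dim ≥ 3. [cite: vanGeemen1994HodgeAV, (5.4.1)] -/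
theorem eightfold_sqrtNeg163_dic5Family_mk_C_ne_split :
    (QuotientGroup.mk (Units.mk0 ((1296 : ℚ) / 125) (by norm_num)) : weilNormResidueGroup 163) ≠
      splitDiscriminantClass 4 163 := by
  rw [Ne, mk_eq_split_iff_of_eq_mul_norm_mul_sq (n := 4) (by decide) (a := (1296 : ℚ) / 125) (C := 5) (ν := 1) (s := 36 / 25)
    (by norm_num) (by norm_num) one_ne_zero (by norm_num) (by norm_num)
    (mem_normUnitsSubgroup_of_sq_add_mul_sq _ 1 0 (by norm_num))]
  exact SqrtNeg163.not_mem_5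

end Summit.HodgeConjecture.HodgeConjecture.Ring2.WeilCoverage

end
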